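import Mathlib
import HarnessLib
import Summits.Ventures.LatticeQCDFlow.Exactness.PTBCCabibboMarinariErgodic
import Summits.Ventures.LatticeQCDFlow.Exactness.PTBCPhysicalMarginal
import Summits.Ventures.LatticeQCDFlow.Exactness.NCMCGeneralSpaceDoeblinPowerCLT
import Summits.Ventures.LatticeQCDFlow.Scoring.DoeblinPowerBatchMeansCLT
import Summits.Ventures.LatticeQCDFlow.Scoring.DoeblinPowerBatchMeansTauInt

/-!
# The engine's PTBC cycle as run — Doeblin exact in-replica sweeps, then the swaps along any list of replica pairs, then the translation of the periodic replica: its one-step certificate; every event (in particular every event of the physical replica) has a finite `τ_int`; burn-in, CLT, batch-means error bars from EVERY start; the `SU(N)` Cabibbo–Marinari instance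

HONEST FRAMING: exact (Metropolis-corrected) sampling algorithms for lattice gauge theory;
figures of merit are autocorrelation/cost numbers at stated couplings and volumes; no
continuum-physics claim.

Venture `LatticeQCDFlow` (cell pub-lqcd), topic `Exactness`, FANOUT row 9 (eng-latcore, GEN-23; the engine
`latflow.core.ptbc` — rows 22–24 `su3-ptbc` / `su3-dsnf`: every replica `q` (defect action `S q`) is swept
(`updates.sweep`, the Cabibbo–Marinari pseudo-heat-bath for `SU(N)`), then neighbouring replicas are swapped and the
periodic replica translated; the cell's R1 figure of merit is `τ_int(Q)` of the PHYSICAL replica).  NEW WORK of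
the cell over the tree, nothing cited as a fact, no number claimed: `PTBCSwapErgodic.lean` /
`PTBCTranslationErgodic.lean` (`ptbcSwaps`, `ptbcTranslation`, `ptbcDensity`, `ptbcTarget`,
`ptbcSwaps_invariant_ptbcTarget`, `ptbcTranslation_invariant_ptbcTarget`, `ptbc_uniformlyErgodic_of_inReplica` —
convergence + uniqueness, the constant explicit but not packaged), `ReplicaProductDoeblin.lean` /
`ReplicaProductInvariant.lean` (`replicaCycle_minorised_left`, `invariant_pi_replicaSweep`),
`PTBCCabibboMarinariErgodic.lean` (`exists_common_minorant`; the CM in-replica sweep), `PTBCPhysicalMarginal.lean`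
(`pi_real_preimage_eval`), `CabibboMarinariLatticeErgodic.lean` (`latSweep_minorised`, `latSweep_invariant_piGibbsLaw`,
`isMarkovKernel_latSweep`), rows 13 / 8 (`…_of_nHit` consequences).  Printed counterparts NAMED ONLY: Hasenbusch
2017; Bonanno–Bonati–D'Elia 2021 (PTBC); Meyn–Tweedie 1993; Flegal–Jones 2010; Madras–Sokal 1988.

## Content (replicas `R`, sites `ι`, finite; reference probability laws `μ_j`; bounded measurable replica actions
## `a ≤ S q ≤ b`; in-replica updates `K r` — Markov, `ε • ⊗μ ≤ K r x` for all `x` with ONE `ε > 0`, each exact for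
## its tempered law `piGibbsLaw μ (e^{−S r})`; a replica scan `L` through every replica; swaps along ANY list `P`
## of pairs; translation of replica `r₀` by a `⊗μ`- and `S r₀`-preserving measurable bijection `T`;
## `C = (ptbcTranslation T r₀ ∘ₖ ptbcSwaps S P) ∘ₖ replicaSweep K L`, `π = ptbcTarget μ (ptbcDensity S)`)

* §1 **`ptbcCycle_certificate`** — `C` leaves `π` invariant and `ε^{|L|} • ν ≤ C(ω, ·) = C^1(ω, ·)` for EVERY
  joint state, `0 < ε^{|L|} ≤ 1`, `ν` the probability law `(⊗_r ⊗μ)(translation ∘ swaps)`;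
  **`ptbcCycle_tauInt_setACF_le`** (ONE `B` for EVERY event of the replica product);
  **`ptbcCycle_physical_tauInt_setACF_le`** (EVERY event `{ω | ω r₁ ∈ B}` of ANY one replica `r₁` — the physical
  one: `τ_int ≤ 1/2 + B'/(1 − π_{r₁}(B))`, `π_{r₁} = piGibbsLaw μ (e^{−S r₁})`); **`ptbcCycle_timeAverage_bias_le`**;
  **`ptbcCycle_timeAverage_clt`**; **`ptbcCycle_batchMeans_tendstoInMeasure`**; **`ptbcCycle_batchMeans_coverage`**;
  **`ptbcCycle_tauInt_tendstoInMeasure`**.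
* §2 THE ENGINE'S `SU(N)` PTBC AS RUN: in-replica update = the Cabibbo–Marinari sweep
  `latSweep (ptbcDensity S q) frames links` (frames through all coordinate pairs, every link):
  **`ptbc_cabibboMarinari_certificate`**, **`ptbc_cabibboMarinari_physical_tauInt_setACF_le`**.

NOT CLAIMED: any value of `ε, B` beyond the displayed pinching ratios; that tempering HELPS (the certificate
ignores the swaps — it is the in-replica sweep that forgets); round-trip / swap-acceptance statistics; the
identification of `S q` with the defect-weighted Wilson action at `c(q)` and of the engine's shift with `T`
(hypotheses, as in `PTBCCabibboMarinariErgodic.lean`); over-relaxation inside the replicas (exact — enters `K r`);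
floating point.
-/

noncomputable section

namespace Summit.Ventures.LatticeQCDFlow.Exactness

open MeasureTheory ProbabilityTheory Set Function Filter Topology
open Summit.Ventures.LatticeQCDFlow.Scoring (replicaSEsq tauInt autocov kop)
open scoped ENNReal

/-! ## §1 Any Doeblin exact in-replica updates, then swaps, then the translation -/

section Cycle

variable {R : Type*} [DecidableEq R] [Fintype R] {ι : Type*} [Fintype ι] {X : ι → Type*}
  [∀ j, MeasurableSpace (X j)] {μ : ∀ j, Measure (X j)} [∀ j, IsProbabilityMeasure (μ j)]
  {S : R → (∀ j, X j) → ℝ}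

/-- **THE ONE-STEP DOEBLIN CERTIFICATE OF THE PTBC CYCLE.**  `C` leaves `ptbcTarget μ (ptbcDensity S)` invariant,
and `ε^{|L|} • ν ≤ C(ω, ·)` for EVERY joint state `ω` with the probability law `ν = (⊗_r ⊗μ)(translation ∘ swaps)`
and `0 < ε^{|L|} ≤ 1`. -/
theorem ptbcCycle_certificate (hS : ∀ q, Measurable (S q)) {a b : ℝ}
    (hab : ∀ q ω, a ≤ S q ω ∧ S q ω ≤ b) {K : R → Kernel (∀ j, X j) (∀ j, X j)} [∀ r, IsMarkovKernel (K r)]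
    {ε : ℝ≥0∞} (hK : ∀ r x, ε • Measure.pi μ ≤ K r x) (hε : 0 < ε)
    (hKinv : ∀ r, Kernel.Invariant (K r) (piGibbsLaw μ (ptbcDensity S r))) {L : List R} (hL : ∀ r, r ∈ L)
    (P : List (R × R)) (T : (∀ j, X j) ≃ᵐ (∀ j, X j)) (hT : MeasurePreserving T (Measure.pi μ) (Measure.pi μ))
    (r₀ : R) (hST : ∀ ω, S r₀ (T ω) = S r₀ ω) :
    Kernel.Invariant ((ptbcTranslation T T.measurable r₀ ∘ₖ ptbcSwaps S P) ∘ₖ replicaSweep K L) (ptbcTarget μ (ptbcDensity S)) ∧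
      IsProbabilityMeasure ((Measure.pi fun _ : R => Measure.pi μ).bind ⇑(ptbcTranslation T T.measurable r₀ ∘ₖ ptbcSwaps S P)) ∧
      0 < ε ^ L.length ∧ ε ^ L.length ≤ 1 ∧ ∀ ω : (R → ∀ j, X j),
        ε ^ L.length • ((Measure.pi fun _ : R => Measure.pi μ).bind ⇑(ptbcTranslation T T.measurable r₀ ∘ₖ ptbcSwaps S P)) ≤
          nHit ((ptbcTranslation T T.measurable r₀ ∘ₖ ptbcSwaps S P) ∘ₖ replicaSweep K L) 1 ω := by
  haveI := isMarkovKernel_ptbcSwaps (S := S) hS P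
  haveI : ∀ q, IsProbabilityMeasure (piGibbsLaw μ (ptbcDensity S q)) := fun q =>
    isProbabilityMeasure_piGibbsLaw (μ := μ) (p := ptbcDensity S q)
      (by rw [Ne, ENNReal.ofReal_eq_zero, not_le]; exact Real.exp_pos (-b)) ENNReal.ofReal_ne_top
      (fun ω => (ptbcDensity_pinched hab q ω).1) (fun ω => (ptbcDensity_pinched hab q ω).2)
  have hη : Kernel.Invariant (ptbcTranslation T T.measurable r₀ ∘ₖ ptbcSwaps S P) (ptbcTarget μ (ptbcDensity S)) :=
    (ptbcTranslation_invariant_ptbcTarget hS hab T hT r₀ hST).comp (ptbcSwaps_invariant_ptbcTarget hS hab P)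
  have hinv : Kernel.Invariant ((ptbcTranslation T T.measurable r₀ ∘ₖ ptbcSwaps S P) ∘ₖ replicaSweep K L) (ptbcTarget μ (ptbcDensity S)) :=
    hη.comp (invariant_pi_replicaSweep (π := fun q => piGibbsLaw μ (ptbcDensity S q)) hKinv L)
  haveI hν : IsProbabilityMeasure ((Measure.pi fun _ : R => Measure.pi μ).bind ⇑(ptbcTranslation T T.measurable r₀ ∘ₖ ptbcSwaps S P)) :=
    ⟨by rw [Measure.bind_apply MeasurableSet.univ (Kernel.aemeasurable _)]; simp⟩
  have hmin : ∀ ω : (R → ∀ j, X j), ε ^ L.length • ((Measure.pi fun _ : R => Measure.pi μ).bind ⇑(ptbcTranslation T T.measurable r₀ ∘ₖ ptbcSwaps S P)) ≤ ((ptbcTranslation T T.measurable r₀ ∘ₖ ptbcSwaps S P) ∘ₖ replicaSweep K L) ω :=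
    replicaCycle_minorised_left (K := K) (ν := fun _ : R => Measure.pi μ) hK hL _
  have hε1 : ε ^ L.length ≤ 1 := by
    obtain ⟨ω⟩ : Nonempty (R → ∀ j, X j) := ⟨fun _ _ => Classical.choice (nonempty_of_isProbabilityMeasure (μ _))⟩
    have h1 := Measure.le_iff'.1 (hmin ω) univ
    rwa [Measure.smul_apply, smul_eq_mul, measure_univ, measure_univ, mul_one] at h1
  refine ⟨hinv, hν, pos_iff_ne_zero.2 (pow_ne_zero _ hε.ne'), hε1, fun ω => ?_⟩
  rw [GeneralNCMC.nHit_one]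
  exact hmin ω

omit [DecidableEq R] in
/-- The PTBC target is a probability law (bounded actions). -/
theorem isProbabilityMeasure_ptbcTarget_ptbcDensity {a b : ℝ}
    (hab : ∀ q ω, a ≤ S q ω ∧ S q ω ≤ b) : IsProbabilityMeasure (ptbcTarget μ (ptbcDensity S)) :=
  isProbabilityMeasure_ptbcTarget (μ := μ) (p := ptbcDensity S)
    (by rw [Ne, ENNReal.ofReal_eq_zero, not_le]; exact Real.exp_pos (-b)) ENNReal.ofReal_ne_top
    (fun q ω => (ptbcDensity_pinched hab q ω).1) (fun q ω => (ptbcDensity_pinched hab q ω).2)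

/-- **EVERY EVENT OF THE REPLICA PRODUCT HAS A FINITE `τ_int` UNDER THE PTBC CYCLE — ONE CONSTANT FOR ALL EVENTS**:
`B ≥ 0` with `τ_int(1_A) ≤ 1/2 + B/(1 − π(A))` for EVERY measurable `A` with `0 < π(A) < 1`. -/
theorem ptbcCycle_tauInt_setACF_le (hS : ∀ q, Measurable (S q)) {a b : ℝ}
    (hab : ∀ q ω, a ≤ S q ω ∧ S q ω ≤ b) {K : R → Kernel (∀ j, X j) (∀ j, X j)} [∀ r, IsMarkovKernel (K r)]
    {ε : ℝ≥0∞} (hK : ∀ r x, ε • Measure.pi μ ≤ K r x) (hε : 0 < ε)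
    (hKinv : ∀ r, Kernel.Invariant (K r) (piGibbsLaw μ (ptbcDensity S r))) {L : List R} (hL : ∀ r, r ∈ L)
    (P : List (R × R)) (T : (∀ j, X j) ≃ᵐ (∀ j, X j)) (hT : MeasurePreserving T (Measure.pi μ) (Measure.pi μ))
    (r₀ : R) (hST : ∀ ω, S r₀ (T ω) = S r₀ ω) :
    ∃ B : ℝ, 0 ≤ B ∧ ∀ A : Set (R → ∀ j, X j), MeasurableSet A →
      0 < (ptbcTarget μ (ptbcDensity S)).real A → (ptbcTarget μ (ptbcDensity S)).real A < 1 →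
      tauInt (setACF ((ptbcTranslation T T.measurable r₀ ∘ₖ ptbcSwaps S P) ∘ₖ replicaSweep K L) (ptbcTarget μ (ptbcDensity S)) A) ≤
        1 / 2 + B / (1 - (ptbcTarget μ (ptbcDensity S)).real A) := by
  haveI := isProbabilityMeasure_ptbcTarget_ptbcDensity (μ := μ) (S := S) hab
  haveI := isMarkovKernel_ptbcSwaps (S := S) hS P
  obtain ⟨hinv, hν, hε0, hε1, hmin⟩ := ptbcCycle_certificate hS hab hK hε hKinv hL P T hT r₀ hST
  have hεtop : ε ^ L.length ≠ ∞ := ne_top_of_le_ne_top ENNReal.one_ne_top hε1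
  have he0 : 0 < (ε ^ L.length).toReal := ENNReal.toReal_pos hε0.ne' hεtop
  have he1 : (ε ^ L.length).toReal ≤ 1 := ENNReal.toReal_le_of_le_ofReal zero_le_one (by simpa using hε1)
  refine ⟨1 / (ε ^ L.length).toReal - 1, ?_, fun A hA h0 h1 => ?_⟩
  · rw [sub_nonneg, le_div_iff₀ he0]; nlinarith
  · simpa using GeneralNCMC.tauInt_setACF_le_of_nHit (GeneralNCMC.minorised_setwise hmin) hε0 hε1
      Nat.one_pos hinv hA h0 h1

/-- **IN PARTICULAR FOR EVERY EVENT OF ONE REPLICA** (the physical one, `r₁`): for EVERY measurable `B` with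
`0 < π_{r₁}(B) < 1` (`π_{r₁} = piGibbsLaw μ (e^{−S r₁})`) the event `{ω | ω r₁ ∈ B}` — e.g. a topological sector of
the physical replica — has `τ_int ≤ 1/2 + B'/(1 − π_{r₁}(B))` under the PTBC cycle, the SAME `B'` for all `B`, `r₁`. -/
theorem ptbcCycle_physical_tauInt_setACF_le (hS : ∀ q, Measurable (S q)) {a b : ℝ}
    (hab : ∀ q ω, a ≤ S q ω ∧ S q ω ≤ b) {K : R → Kernel (∀ j, X j) (∀ j, X j)} [∀ r, IsMarkovKernel (K r)]
    {ε : ℝ≥0∞} (hK : ∀ r x, ε • Measure.pi μ ≤ K r x) (hε : 0 < ε)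
    (hKinv : ∀ r, Kernel.Invariant (K r) (piGibbsLaw μ (ptbcDensity S r))) {L : List R} (hL : ∀ r, r ∈ L)
    (P : List (R × R)) (T : (∀ j, X j) ≃ᵐ (∀ j, X j)) (hT : MeasurePreserving T (Measure.pi μ) (Measure.pi μ))
    (r₀ : R) (hST : ∀ ω, S r₀ (T ω) = S r₀ ω) :
    ∃ B' : ℝ, 0 ≤ B' ∧ ∀ (r₁ : R) (B : Set (∀ j, X j)), MeasurableSet B →
      0 < (piGibbsLaw μ (ptbcDensity S r₁)).real B → (piGibbsLaw μ (ptbcDensity S r₁)).real B < 1 →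
      tauInt (setACF ((ptbcTranslation T T.measurable r₀ ∘ₖ ptbcSwaps S P) ∘ₖ replicaSweep K L) (ptbcTarget μ (ptbcDensity S)) (Function.eval r₁ ⁻¹' B)) ≤
        1 / 2 + B' / (1 - (piGibbsLaw μ (ptbcDensity S r₁)).real B) := by
  haveI : ∀ q, IsProbabilityMeasure (piGibbsLaw μ (ptbcDensity S q)) := fun q =>
    isProbabilityMeasure_piGibbsLaw (μ := μ) (p := ptbcDensity S q)
      (by rw [Ne, ENNReal.ofReal_eq_zero, not_le]; exact Real.exp_pos (-b)) ENNReal.ofReal_ne_top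
      (fun ω => (ptbcDensity_pinched hab q ω).1) (fun ω => (ptbcDensity_pinched hab q ω).2)
  obtain ⟨B', hB', h⟩ := ptbcCycle_tauInt_setACF_le hS hab hK hε hKinv hL P T hT r₀ hST
  refine ⟨B', hB', fun r₁ B hB h0 h1 => ?_⟩
  have hmarg : (ptbcTarget μ (ptbcDensity S)).real (Function.eval r₁ ⁻¹' B) = (piGibbsLaw μ (ptbcDensity S r₁)).real B := by
    unfold ptbcTarget
    exact pi_real_preimage_eval (π := fun r => piGibbsLaw μ (ptbcDensity S r)) r₁ hB
  have h' := h (Function.eval r₁ ⁻¹' B) ((measurable_pi_apply r₁) hB) (hmarg ▸ h0) (hmarg ▸ h1)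
  rwa [hmarg] at h'

/-- **CERTIFIED BURN-IN OF THE PTBC CHAIN FROM EVERY START**: one `B ≥ 0` with
`|E_{μ₀}[(1/n) Σ_{t<n} g(ω_t)] − ∫ g dπ| ≤ B/n` for EVERY initial law, every `[0,1]`-valued measurable `g`, `n ≥ 1`. -/
theorem ptbcCycle_timeAverage_bias_le (hS : ∀ q, Measurable (S q)) {a b : ℝ}
    (hab : ∀ q ω, a ≤ S q ω ∧ S q ω ≤ b) {K : R → Kernel (∀ j, X j) (∀ j, X j)} [∀ r, IsMarkovKernel (K r)]
    {ε : ℝ≥0∞} (hK : ∀ r x, ε • Measure.pi μ ≤ K r x) (hε : 0 < ε)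
    (hKinv : ∀ r, Kernel.Invariant (K r) (piGibbsLaw μ (ptbcDensity S r))) {L : List R} (hL : ∀ r, r ∈ L)
    (P : List (R × R)) (T : (∀ j, X j) ≃ᵐ (∀ j, X j)) (hT : MeasurePreserving T (Measure.pi μ) (Measure.pi μ))
    (r₀ : R) (hST : ∀ ω, S r₀ (T ω) = S r₀ ω)
    [IsMarkovKernel (ptbcSwaps S P)] :
    ∃ B : ℝ, 0 ≤ B ∧ ∀ (μ₀ : Measure (R → ∀ j, X j)) [IsProbabilityMeasure μ₀]
      (g : (R → ∀ j, X j) → ℝ), Measurable g → (∀ ω, 0 ≤ g ω) → (∀ ω, g ω ≤ 1) →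
      ∀ n : ℕ, n ≠ 0 →
      |∫ x, (∑ t ∈ Finset.range n, g (x t)) / n
          ∂(Kernel.trajMeasure (X := fun _ : ℕ => (R → ∀ j, X j)) μ₀
              (fun t : ℕ => ((ptbcTranslation T T.measurable r₀ ∘ₖ ptbcSwaps S P) ∘ₖ replicaSweep K L).comap
                (fun h : (i : ↥(Finset.Iic t)) → (R → ∀ j, X j) =>
                  h ⟨t, Finset.mem_Iic.2 le_rfl⟩) (measurable_pi_apply _)))
        - ∫ ω, g ω ∂(ptbcTarget μ (ptbcDensity S))| ≤ B / n := by
  haveI := isProbabilityMeasure_ptbcTarget_ptbcDensity (μ := μ) (S := S) hab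
  obtain ⟨hinv, hν, hε0, hε1, hmin⟩ := ptbcCycle_certificate hS hab hK hε hKinv hL P T hT r₀ hST
  have he0 : 0 < (ε ^ L.length).toReal :=
    ENNReal.toReal_pos hε0.ne' (ne_top_of_le_ne_top ENNReal.one_ne_top hε1)
  refine ⟨1 / (ε ^ L.length).toReal, by positivity, fun μ₀ _ g hg h0 h1 n hn0 => ?_⟩
  calc _ ≤ ((1 : ℕ) : ℝ) / ((ε ^ L.length).toReal * n) :=
        GeneralNCMC.chain_timeAverage_bias_le_of_nHit (GeneralNCMC.minorised_setwise hmin) hε0 hε1 Nat.one_pos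
          hinv μ₀ hg h0 h1 hn0
    _ = 1 / (ε ^ L.length).toReal / n := by rw [Nat.cast_one, div_div]

/-- **THE CLT FOR TIME AVERAGES OF THE PTBC CHAIN, FROM EVERY INITIAL LAW** (`|f| ≤ C` measurable on the joint state
— e.g. an observable of the physical replica; `Y ~ N(0, σ²_f)`): `(√n)⁻¹ Σ_{t<n} (f(ω_t) − π f) ⇒ Y`. -/
theorem ptbcCycle_timeAverage_clt (hS : ∀ q, Measurable (S q)) {a b : ℝ}
    (hab : ∀ q ω, a ≤ S q ω ∧ S q ω ≤ b) {K : R → Kernel (∀ j, X j) (∀ j, X j)} [∀ r, IsMarkovKernel (K r)]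
    {ε : ℝ≥0∞} (hK : ∀ r x, ε • Measure.pi μ ≤ K r x) (hε : 0 < ε)
    (hKinv : ∀ r, Kernel.Invariant (K r) (piGibbsLaw μ (ptbcDensity S r))) {L : List R} (hL : ∀ r, r ∈ L)
    (P : List (R × R)) (T : (∀ j, X j) ≃ᵐ (∀ j, X j)) (hT : MeasurePreserving T (Measure.pi μ) (Measure.pi μ))
    (r₀ : R) (hST : ∀ ω, S r₀ (T ω) = S r₀ ω)
    [IsMarkovKernel (ptbcSwaps S P)]
    {f : (R → ∀ j, X j) → ℝ} (hf : Measurable f) {C : ℝ} (hC : ∀ ω, |f ω| ≤ C)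
    (μ₀ : Measure (R → ∀ j, X j)) [IsProbabilityMeasure μ₀]
    [IsProbabilityMeasure (Kernel.trajMeasure (X := fun _ : ℕ => (R → ∀ j, X j)) μ₀
              (fun t : ℕ => ((ptbcTranslation T T.measurable r₀ ∘ₖ ptbcSwaps S P) ∘ₖ replicaSweep K L).comap
                (fun h : (i : ↥(Finset.Iic t)) → (R → ∀ j, X j) =>
                  h ⟨t, Finset.mem_Iic.2 le_rfl⟩) (measurable_pi_apply _)))]
    {Ω' : Type*} [MeasurableSpace Ω'] {P' : Measure Ω'} [IsProbabilityMeasure P'] {Y : Ω' → ℝ}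
    (hY : HasLaw Y (gaussianReal 0 (Real.toNNReal
      ((∫ y, (f y - ∫ z, f z ∂(ptbcTarget μ (ptbcDensity S))) ^ 2 ∂(ptbcTarget μ (ptbcDensity S)))
              + 2 * ∑' k, ∫ y, (f y - ∫ z, f z ∂(ptbcTarget μ (ptbcDensity S)))
                * (kop ((ptbcTranslation T T.measurable r₀ ∘ₖ ptbcSwaps S P) ∘ₖ replicaSweep K L))^[k + 1]
                  (fun y => f y - ∫ z, f z ∂(ptbcTarget μ (ptbcDensity S))) y ∂(ptbcTarget μ (ptbcDensity S))))) P') :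
    TendstoInDistribution (fun (n : ℕ) (x : ℕ → (R → ∀ j, X j)) =>
        (Real.sqrt n)⁻¹ * ∑ t ∈ Finset.range n, (f (x t) - ∫ z, f z ∂(ptbcTarget μ (ptbcDensity S))))
      atTop Y (fun _ => (Kernel.trajMeasure (X := fun _ : ℕ => (R → ∀ j, X j)) μ₀
              (fun t : ℕ => ((ptbcTranslation T T.measurable r₀ ∘ₖ ptbcSwaps S P) ∘ₖ replicaSweep K L).comap
                (fun h : (i : ↥(Finset.Iic t)) → (R → ∀ j, X j) =>
                  h ⟨t, Finset.mem_Iic.2 le_rfl⟩) (measurable_pi_apply _)))) P' := by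
  haveI := isProbabilityMeasure_ptbcTarget_ptbcDensity (μ := μ) (S := S) hab
  obtain ⟨hinv, hν, hε0, -, hmin⟩ := ptbcCycle_certificate hS hab hK hε hKinv hL P T hT r₀ hST
  exact GeneralNCMC.tendstoInDistribution_timeAverage_of_nHit hinv hε0.ne' hmin Nat.one_pos hf hC μ₀ hY

/-- **BATCH MEANS ESTIMATE `σ²_f` CONSISTENTLY ALONG THE PTBC CHAIN, FROM EVERY INITIAL LAW.** -/
theorem ptbcCycle_batchMeans_tendstoInMeasure (hS : ∀ q, Measurable (S q)) {a b : ℝ}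
    (hab : ∀ q ω, a ≤ S q ω ∧ S q ω ≤ b) {K : R → Kernel (∀ j, X j) (∀ j, X j)} [∀ r, IsMarkovKernel (K r)]
    {ε : ℝ≥0∞} (hK : ∀ r x, ε • Measure.pi μ ≤ K r x) (hε : 0 < ε)
    (hKinv : ∀ r, Kernel.Invariant (K r) (piGibbsLaw μ (ptbcDensity S r))) {L : List R} (hL : ∀ r, r ∈ L)
    (P : List (R × R)) (T : (∀ j, X j) ≃ᵐ (∀ j, X j)) (hT : MeasurePreserving T (Measure.pi μ) (Measure.pi μ))
    (r₀ : R) (hST : ∀ ω, S r₀ (T ω) = S r₀ ω)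
    [IsMarkovKernel (ptbcSwaps S P)]
    {f : (R → ∀ j, X j) → ℝ} (hf : Measurable f) {C : ℝ} (hC : ∀ ω, |f ω| ≤ C)
    (μ₀ : Measure (R → ∀ j, X j)) [IsProbabilityMeasure μ₀]
    {a' b' : ℕ → ℕ} (ha : Tendsto a' atTop atTop) (hb' : Tendsto b' atTop atTop) :
    TendstoInMeasure (Kernel.trajMeasure (X := fun _ : ℕ => (R → ∀ j, X j)) μ₀
              (fun t : ℕ => ((ptbcTranslation T T.measurable r₀ ∘ₖ ptbcSwaps S P) ∘ₖ replicaSweep K L).comap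
                (fun h : (i : ↥(Finset.Iic t)) → (R → ∀ j, X j) =>
                  h ⟨t, Finset.mem_Iic.2 le_rfl⟩) (measurable_pi_apply _)))
      (fun (n : ℕ) (x : ℕ → (R → ∀ j, X j)) => ((b' n * a' n : ℕ) : ℝ)
        * replicaSEsq (fun j (x : ℕ → (R → ∀ j, X j)) =>
            (∑ i ∈ Finset.range (b' n), f (x (b' n * j + i))) / (b' n)) (a' n) x)
      atTop (fun _ => (∫ y, (f y - ∫ z, f z ∂(ptbcTarget μ (ptbcDensity S))) ^ 2 ∂(ptbcTarget μ (ptbcDensity S)))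
              + 2 * ∑' k, ∫ y, (f y - ∫ z, f z ∂(ptbcTarget μ (ptbcDensity S)))
                * (kop ((ptbcTranslation T T.measurable r₀ ∘ₖ ptbcSwaps S P) ∘ₖ replicaSweep K L))^[k + 1]
                  (fun y => f y - ∫ z, f z ∂(ptbcTarget μ (ptbcDensity S))) y ∂(ptbcTarget μ (ptbcDensity S))) := by
  haveI := isProbabilityMeasure_ptbcTarget_ptbcDensity (μ := μ) (S := S) hab
  obtain ⟨hinv, hν, hε0, hε1, hmin⟩ := ptbcCycle_certificate hS hab hK hε hKinv hL P T hT r₀ hST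
  exact Scoring.chain_batchMeans_sigmaHat_tendstoInMeasure_of_nHit hinv (GeneralNCMC.minorised_setwise hmin)
    hε0 hε1 Nat.one_pos hf hC μ₀ ha hb'

/-- **THE BATCH-MEANS INTERVAL OF A PTBC RUN IS ASYMPTOTICALLY EXACT** (`σ²_f > 0`, any initial law, `z > 0`). -/
theorem ptbcCycle_batchMeans_coverage (hS : ∀ q, Measurable (S q)) {a b : ℝ}
    (hab : ∀ q ω, a ≤ S q ω ∧ S q ω ≤ b) {K : R → Kernel (∀ j, X j) (∀ j, X j)} [∀ r, IsMarkovKernel (K r)]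
    {ε : ℝ≥0∞} (hK : ∀ r x, ε • Measure.pi μ ≤ K r x) (hε : 0 < ε)
    (hKinv : ∀ r, Kernel.Invariant (K r) (piGibbsLaw μ (ptbcDensity S r))) {L : List R} (hL : ∀ r, r ∈ L)
    (P : List (R × R)) (T : (∀ j, X j) ≃ᵐ (∀ j, X j)) (hT : MeasurePreserving T (Measure.pi μ) (Measure.pi μ))
    (r₀ : R) (hST : ∀ ω, S r₀ (T ω) = S r₀ ω)
    [IsMarkovKernel (ptbcSwaps S P)]
    {f : (R → ∀ j, X j) → ℝ} (hf : Measurable f) {C : ℝ} (hC : ∀ ω, |f ω| ≤ C)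
    (hσ : 0 < (∫ y, (f y - ∫ z, f z ∂(ptbcTarget μ (ptbcDensity S))) ^ 2 ∂(ptbcTarget μ (ptbcDensity S)))
              + 2 * ∑' k, ∫ y, (f y - ∫ z, f z ∂(ptbcTarget μ (ptbcDensity S)))
                * (kop ((ptbcTranslation T T.measurable r₀ ∘ₖ ptbcSwaps S P) ∘ₖ replicaSweep K L))^[k + 1]
                  (fun y => f y - ∫ z, f z ∂(ptbcTarget μ (ptbcDensity S))) y ∂(ptbcTarget μ (ptbcDensity S)))
    (μ₀ : Measure (R → ∀ j, X j)) [IsProbabilityMeasure μ₀]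
    {a' b' : ℕ → ℕ} (ha : Tendsto a' atTop atTop) (hb' : Tendsto b' atTop atTop) {z : ℝ} (hz : 0 < z) :
    Tendsto (fun n : ℕ => (Kernel.trajMeasure (X := fun _ : ℕ => (R → ∀ j, X j)) μ₀
              (fun t : ℕ => ((ptbcTranslation T T.measurable r₀ ∘ₖ ptbcSwaps S P) ∘ₖ replicaSweep K L).comap
                (fun h : (i : ↥(Finset.Iic t)) → (R → ∀ j, X j) =>
                  h ⟨t, Finset.mem_Iic.2 le_rfl⟩) (measurable_pi_apply _))).real
      {x | |((Real.sqrt ((b' n * a' n : ℕ) : ℝ))⁻¹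
          * ∑ t ∈ Finset.range (b' n * a' n), (f (x t) - ∫ z, f z ∂(ptbcTarget μ (ptbcDensity S))))
        / Real.sqrt (((b' n * a' n : ℕ) : ℝ)
          * replicaSEsq (fun j (x : ℕ → (R → ∀ j, X j)) =>
              (∑ i ∈ Finset.range (b' n), f (x (b' n * j + i))) / (b' n)) (a' n) x)| ≤ z})
      atTop (𝓝 ((gaussianReal 0 1).real (Set.Icc (-z) z))) := by
  haveI := isProbabilityMeasure_ptbcTarget_ptbcDensity (μ := μ) (S := S) hab
  obtain ⟨hinv, hν, hε0, hε1, hmin⟩ := ptbcCycle_certificate hS hab hK hε hKinv hL P T hT r₀ hST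
  exact Scoring.doeblinPower_batchMeans_studentized_coverage hinv hmin hε0 hε1 Nat.one_pos hf hC hσ μ₀ ha hb' hz

/-- **THE REPORTED `τ̂_int = σ̂²_BM/(2 v̂)` OF A PTBC RUN IS CONSISTENT** (`Var_π f ≠ 0`, any initial law). -/
theorem ptbcCycle_tauInt_tendstoInMeasure (hS : ∀ q, Measurable (S q)) {a b : ℝ}
    (hab : ∀ q ω, a ≤ S q ω ∧ S q ω ≤ b) {K : R → Kernel (∀ j, X j) (∀ j, X j)} [∀ r, IsMarkovKernel (K r)]
    {ε : ℝ≥0∞} (hK : ∀ r x, ε • Measure.pi μ ≤ K r x) (hε : 0 < ε)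
    (hKinv : ∀ r, Kernel.Invariant (K r) (piGibbsLaw μ (ptbcDensity S r))) {L : List R} (hL : ∀ r, r ∈ L)
    (P : List (R × R)) (T : (∀ j, X j) ≃ᵐ (∀ j, X j)) (hT : MeasurePreserving T (Measure.pi μ) (Measure.pi μ))
    (r₀ : R) (hST : ∀ ω, S r₀ (T ω) = S r₀ ω)
    [IsMarkovKernel (ptbcSwaps S P)]
    {f : (R → ∀ j, X j) → ℝ} (hf : Measurable f) {C : ℝ} (hC : ∀ ω, |f ω| ≤ C)
    (hvar : autocov ((ptbcTranslation T T.measurable r₀ ∘ₖ ptbcSwaps S P) ∘ₖ replicaSweep K L)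
        (ptbcTarget μ (ptbcDensity S)) (fun y => f y - ∫ z, f z ∂(ptbcTarget μ (ptbcDensity S))) 0 ≠ 0)
    (μ₀ : Measure (R → ∀ j, X j)) [IsProbabilityMeasure μ₀]
    {a' b' : ℕ → ℕ} (ha : Tendsto a' atTop atTop) (hb' : Tendsto b' atTop atTop) :
    TendstoInMeasure (Kernel.trajMeasure (X := fun _ : ℕ => (R → ∀ j, X j)) μ₀
              (fun t : ℕ => ((ptbcTranslation T T.measurable r₀ ∘ₖ ptbcSwaps S P) ∘ₖ replicaSweep K L).comap
                (fun h : (i : ↥(Finset.Iic t)) → (R → ∀ j, X j) =>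
                  h ⟨t, Finset.mem_Iic.2 le_rfl⟩) (measurable_pi_apply _)))
      (fun (n : ℕ) (x : ℕ → (R → ∀ j, X j)) =>
        (((b' n * a' n : ℕ) : ℝ)
          * replicaSEsq (fun j (x : ℕ → (R → ∀ j, X j)) =>
              (∑ i ∈ Finset.range (b' n), f (x (b' n * j + i))) / (b' n)) (a' n) x)
        / (2 * ((∑ t ∈ Finset.range (b' n * a' n), f (x t) ^ 2) / ((b' n * a' n : ℕ) : ℝ)
            - ((∑ t ∈ Finset.range (b' n * a' n), f (x t)) / ((b' n * a' n : ℕ) : ℝ)) ^ 2)))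
      atTop (fun _ => tauInt (fun t =>
        autocov ((ptbcTranslation T T.measurable r₀ ∘ₖ ptbcSwaps S P) ∘ₖ replicaSweep K L)
            (ptbcTarget μ (ptbcDensity S)) (fun y => f y - ∫ z, f z ∂(ptbcTarget μ (ptbcDensity S))) t
          / autocov ((ptbcTranslation T T.measurable r₀ ∘ₖ ptbcSwaps S P) ∘ₖ replicaSweep K L)
            (ptbcTarget μ (ptbcDensity S)) (fun y => f y - ∫ z, f z ∂(ptbcTarget μ (ptbcDensity S))) 0)) := by
  haveI := isProbabilityMeasure_ptbcTarget_ptbcDensity (μ := μ) (S := S) hab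
  obtain ⟨hinv, hν, hε0, hε1, hmin⟩ := ptbcCycle_certificate hS hab hK hε hKinv hL P T hT r₀ hST
  exact Scoring.chain_batchMeans_tauInt_tendstoInMeasure_of_nHit hinv hmin hε0 hε1 Nat.one_pos hf hC hvar μ₀ ha hb'

end Cycle

/-! ## §2 The engine's `SU(N)` PTBC as run: Cabibbo–Marinari in-replica sweeps -/

section CM

variable {R : Type*} [DecidableEq R] [Fintype R] {n : Type*} [Fintype n] [DecidableEq n] [Nonempty n]
  [LinearOrder n] {ι : Type*} [Fintype ι] [DecidableEq ι] {m : Type*} [Fintype m] [DecidableEq m]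
  {S : R → Cfg ι n → ℝ}

/-- **THE ONE-STEP DOEBLIN CERTIFICATE OF THE ENGINE'S `SU(N)` PTBC CYCLE AS RUN**: in-replica update = the
Cabibbo–Marinari sweep `latSweep (ptbcDensity S q) frames links` (frames through all coordinate pairs, every link),
then the swaps along `P`, then the translation of `r₀` by `T`.  The cycle leaves `ptbcTarget` invariant and
`ε₀^{|L|} • ν ≤ C(ω, ·)` for EVERY joint state with ONE `ε₀ > 0`, `ν` a probability law. -/
theorem ptbc_cabibboMarinari_certificate (hS : ∀ q, Measurable (S q)) {a b : ℝ}
    (hab : ∀ q ω, a ≤ S q ω ∧ S q ω ≤ b) (frames : List (n ≃ Fin 2 ⊕ m))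
    (hlex : frames.map pairOf = lexPairs (Finset.univ.sort (· ≤ ·) : List n) ∨
      frames.map pairOf = (lexPairs (Finset.univ.sort (· ≤ ·) : List n)).reverse)
    {links : List ι} (hl : ∀ l, l ∈ links) {L : List R} (hL : ∀ r, r ∈ L) (P : List (R × R))
    (T : Cfg ι n ≃ᵐ Cfg ι n) (hT : MeasurePreserving T (Measure.pi (linkHaar ι n)) (Measure.pi (linkHaar ι n)))
    (r₀ : R) (hST : ∀ ω, S r₀ (T ω) = S r₀ ω) :
    Kernel.Invariant ((ptbcTranslation T T.measurable r₀ ∘ₖ ptbcSwaps S P) ∘ₖ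
        replicaSweep (fun q => latSweep (ptbcDensity S q) frames links) L)
        (ptbcTarget (linkHaar ι n) (ptbcDensity S)) ∧
      ∃ ε' : ℝ≥0∞, 0 < ε' ∧ ε' ≤ 1 ∧ ∀ ω : R → Cfg ι n,
        ε' • ((Measure.pi fun _ : R => Measure.pi (linkHaar ι n)).bind
            ⇑(ptbcTranslation T T.measurable r₀ ∘ₖ ptbcSwaps S P)) ≤
          nHit ((ptbcTranslation T T.measurable r₀ ∘ₖ ptbcSwaps S P) ∘ₖ
            replicaSweep (fun q => latSweep (ptbcDensity S q) frames links) L) 1 ω := by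
  have hm0 : ENNReal.ofReal (Real.exp (-b)) ≠ 0 := by
    rw [Ne, ENNReal.ofReal_eq_zero, not_le]; exact Real.exp_pos (-b)
  have hlo : ∀ q ω, ENNReal.ofReal (Real.exp (-b)) ≤ ptbcDensity S q ω := fun q ω => (ptbcDensity_pinched hab q ω).1
  have hhi : ∀ q ω, ptbcDensity S q ω ≤ ENNReal.ofReal (Real.exp (-a)) := fun q ω => (ptbcDensity_pinched hab q ω).2
  haveI : ∀ q, IsMarkovKernel (latSweep (ptbcDensity S q) frames links) := fun q =>
    isMarkovKernel_latSweep (measurable_ptbcDensity hS q) hm0 ENNReal.ofReal_ne_top (hlo q) (hhi q) frames links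
  choose ε hε hmin using fun q => latSweep_minorised (measurable_ptbcDensity hS q) hm0 ENNReal.ofReal_ne_top
    (hlo q) (hhi q) frames hlex hl
  obtain ⟨hε0, hcommon⟩ := exists_common_minorant (K := fun q => latSweep (ptbcDensity S q) frames links)
    (ν := Measure.pi (linkHaar ι n)) hε hmin
  obtain ⟨hinv, -, hpos, hle, hcert⟩ := ptbcCycle_certificate (μ := linkHaar ι n) hS hab hcommon
    (pos_iff_ne_zero.2 hε0)
    (fun q => latSweep_invariant_piGibbsLaw (measurable_ptbcDensity hS q) hm0 ENNReal.ofReal_ne_top (hlo q) (hhi q)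
      frames links) hL P T hT r₀ hST
  exact ⟨hinv, _, hpos, hle, hcert⟩

/-- **EVERY EVENT OF THE PHYSICAL REPLICA HAS A FINITE `τ_int` UNDER THE ENGINE'S `SU(N)` PTBC CYCLE AS RUN**: one
`B' ≥ 0` with `τ_int(1_{ω r₁ ∈ B}) ≤ 1/2 + B'/(1 − π_{r₁}(B))` for EVERY replica `r₁` and EVERY measurable `B` with
`0 < π_{r₁}(B) < 1` (a topological sector of the periodic replica, say). -/
theorem ptbc_cabibboMarinari_physical_tauInt_setACF_le (hS : ∀ q, Measurable (S q)) {a b : ℝ}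
    (hab : ∀ q ω, a ≤ S q ω ∧ S q ω ≤ b) (frames : List (n ≃ Fin 2 ⊕ m))
    (hlex : frames.map pairOf = lexPairs (Finset.univ.sort (· ≤ ·) : List n) ∨
      frames.map pairOf = (lexPairs (Finset.univ.sort (· ≤ ·) : List n)).reverse)
    {links : List ι} (hl : ∀ l, l ∈ links) {L : List R} (hL : ∀ r, r ∈ L) (P : List (R × R))
    (T : Cfg ι n ≃ᵐ Cfg ι n) (hT : MeasurePreserving T (Measure.pi (linkHaar ι n)) (Measure.pi (linkHaar ι n)))
    (r₀ : R) (hST : ∀ ω, S r₀ (T ω) = S r₀ ω) :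
    ∃ B' : ℝ, 0 ≤ B' ∧ ∀ (r₁ : R) (B : Set (Cfg ι n)), MeasurableSet B →
      0 < (piGibbsLaw (linkHaar ι n) (ptbcDensity S r₁)).real B →
      (piGibbsLaw (linkHaar ι n) (ptbcDensity S r₁)).real B < 1 →
      tauInt (setACF ((ptbcTranslation T T.measurable r₀ ∘ₖ ptbcSwaps S P) ∘ₖ
          replicaSweep (fun q => latSweep (ptbcDensity S q) frames links) L)
          (ptbcTarget (linkHaar ι n) (ptbcDensity S)) (Function.eval r₁ ⁻¹' B)) ≤
        1 / 2 + B' / (1 - (piGibbsLaw (linkHaar ι n) (ptbcDensity S r₁)).real B) := by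
  have hm0 : ENNReal.ofReal (Real.exp (-b)) ≠ 0 := by
    rw [Ne, ENNReal.ofReal_eq_zero, not_le]; exact Real.exp_pos (-b)
  have hlo : ∀ q ω, ENNReal.ofReal (Real.exp (-b)) ≤ ptbcDensity S q ω := fun q ω => (ptbcDensity_pinched hab q ω).1
  have hhi : ∀ q ω, ptbcDensity S q ω ≤ ENNReal.ofReal (Real.exp (-a)) := fun q ω => (ptbcDensity_pinched hab q ω).2
  haveI : ∀ q, IsMarkovKernel (latSweep (ptbcDensity S q) frames links) := fun q =>
    isMarkovKernel_latSweep (measurable_ptbcDensity hS q) hm0 ENNReal.ofReal_ne_top (hlo q) (hhi q) frames links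
  choose ε hε hmin using fun q => latSweep_minorised (measurable_ptbcDensity hS q) hm0 ENNReal.ofReal_ne_top
    (hlo q) (hhi q) frames hlex hl
  obtain ⟨hε0, hcommon⟩ := exists_common_minorant (K := fun q => latSweep (ptbcDensity S q) frames links)
    (ν := Measure.pi (linkHaar ι n)) hε hmin
  exact ptbcCycle_physical_tauInt_setACF_le (μ := linkHaar ι n) hS hab hcommon (pos_iff_ne_zero.2 hε0)
    (fun q => latSweep_invariant_piGibbsLaw (measurable_ptbcDensity hS q) hm0 ENNReal.ofReal_ne_top (hlo q) (hhi q)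
      frames links) hL P T hT r₀ hST

end CM

end Summit.Ventures.LatticeQCDFlow.Exactness

end
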